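import Literature.MathematicalPhysics.QuantumFieldTheory.Balaban1983to89.B15Prop1CoerciveEditionNearRadius
import Literature.MathematicalPhysics.QuantumFieldTheory.Balaban1983to89.B15Prop1GradientFromNearValueB

/-!
# `Balaban1983to89.B15Prop1CoerciveEditionNearRadiusB` — [Balaban1989LargeFieldI] (= [B15]) (1.74) p. 192, (1.77) p. 194; [Balaban1989LargeFieldII] (1.15) p. 359; [Balaban1988Convergent] (= [III]) (1.12) p. 248,
# (2.12)–(2.13) pp. 256–257; [Balaban1984PropagatorsII] (= [II]) (2.3) p. 224: THE TRANSFER LETTER OF THE (J0′) ROAD **OVER A BOND-LEVEL DATUM** — the print-datum edition of §1 of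
# `B15Prop1CoerciveEditionNearRadius` (the two datum-bearing declarations of that module's §1 that N12's junction of record uses: `fun177std_eq_nearValue_add_far_of_isMinimizer`,
# `transferLetter_of_minimiserFamily`) (THEOREMS ONLY; the §2 head `…_ofMinimiserFamily_ofCoercive_nearRadius` is twinned separately, after its `_nearExt` input)

statement-level skeleton of published theorems with citation tags; proofs where landed; nothing here is a claim about
the Yang–Mills mass gap

Cell `pub-ymgap` (HUMAN RULINGS D-0062 ∕ D-0149), lane `pub-ymgap-dag-n12-c` g35 (R134 seat (a), N12 = [B15], s1); `--kind proof --supports` K1⁹ `stmt-QuantumFields-27364`;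
count-neutral.  THEOREMS ONLY (0 `def`, 0 `instance`, 0 `sorry`).  (E1) variant (iii-b), class (β) of the lane's census-by-declaration (bus [DAGN12C-G35]).  As in `B15Prop1GradientFromNearValueB`:
print's datum pins a minimiser only on the bonds with BOTH end-points off `Ω₁(Z)` (displayed level-`0` clause `hbd0`, discharged at print's family in the `_lamDatumP` corollaries); the far
plaquettes read only such bonds, so the parent's proofs go through with `IsMinimizerB.pinned₂ ∕ plaqHol_congr_of_not_mem_plaqsOf₂`; the datum-free `qsstarGIter0_congr_of_far`,
`exists_expMul_eq_of_dist1`, `eq115`, `wilsonLoc_congr` are REUSED.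

HONESTY GUARD (director-ym №338 (5)).  PURELY ADDITIVE: the (b)-keyed parent stays landed and true on its own text; no displayed premise of any consumer is deleted or weakened.

WHAT IS HERE.  ★ `fun177stdB_eq_nearValue_add_far_of_isMinimizerB` · ★★ `transferLetterB_of_minimiserFamily` (at `Node00.bgOfRecordB av reg` over `bd`, clause `hbd0`) · `transferLetterB_of_minimiserFamily_lamDatumP`.

HONEST SCOPE.  Bookkeeping; solvability along the family is a HYPOTHESIS (`hreal`); nothing of [15] Thm 1 ∕ Prop. 9 asserted; count-neutral; N12 NOT discharged; K0⁷ ∕ K1⁹ NOT closed; one finite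
𝕋⁴ programme at fixed ε — nothing continuum ∕ ℝ⁴ ∕ OS; the Yang–Mills mass gap (Clay) is NOT proved by any of this.

References: [B15] = [Balaban1989LargeFieldI] (1.74) p.192, (1.77) p.194; [Balaban1989LargeFieldII] (1.2)–(1.6) p.357, (1.15) p.359, p.359; [III] = [Balaban1988Convergent] (1.3) p.246, (1.12) p.248,
(2.12)–(2.13) pp.256–257, (2.16) p.257; [II] = [Balaban1984PropagatorsII] (2.3) p.224; [15] = [Balaban1985Variational] (5) p.278, Prop. 9 p.309.
-/

noncomputable section

open Set Finset Metric Filter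
open scoped BigOperators Matrix RealInnerProductSpace InnerProductSpace Topology

namespace Literature.MathematicalPhysics.QuantumFieldTheory.Balaban1983to89.B15Prop1CoerciveEditionNearRadius

open B15DeterminingSets B15DeterminingSetsB GaugeField B16Sect1Backgrounds B15Prop1Carrier B8Eq17ClassAkV1 BlockAveraging
open B15Prop1GradientFromNearValue
open B15Prop1ChartCalculusSU2 (E3)
open T4CubeChartGnomonic (SU2)
open B15Prop1ChartSU2 (su2Chart)
open B14.Eq213MaximalDomains (side)
open B14.Eq213DetSet B14.Eq216Concrete B15Sect1Instances B15Eq177ValueInvariance B16Sect1Wilson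
open B14.Eq22Determines (blockIter IsBlockUnion)
open Literature.MathematicalPhysics.QuantumFieldTheory.BalabanImbrieJaffe1984to88.BIJ85Eq453GaugeField
open T4Continuum
open Classical

/-! ## §1  The transfer letter on the (J0′) minimiser-family road, bond datum -/

section TransferB

variable {P : Params}

/-- ★ **AT A SOLVABLE BOND DATUM, TOTAL = NEAR + THE FAR ACTION OF THE PINNED PULL-BACK** — for `bg := Node00.bgOfRecordB av reg` over a bond-datum family `bd` with the level-`0` clause `hbd0`,
`k ≤ m + K`, the letter `hfar`, and `W` equal to `W₀` off the `Λ`-bonds whose (1.74) problem on the bonds `bd k {Ω_j(Z)}` is solvable: `A(U_{k,Z}(W)) = Σ_{p ∈ plaqsOf Ω₁(Z)} (1 − Re tr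
U_{k,Z}(W)(∂p)) + A_far(Q_k^{s*}W₀)`; twin of `fun177std_eq_nearValue_add_far_of_isMinimizer`. [cite: Balaban1989LargeFieldII, (1.15) p.359, (1.2)–(1.6) p.357; Balaban1988Convergent, (1.12) p.248, (2.12)–(2.13) pp.256–257; Balaban1989LargeFieldI, (1.74) p.192, (1.77) p.194; Balaban1984PropagatorsII, (2.3) p.224] -/
theorem fun177stdB_eq_nearValue_add_far_of_isMinimizerB (av : ∀ j, Averaging P j SU2) (reg : Set (GaugeField P 0 SU2)) (M₁ : ℕ)
    (bd : ℕ → (ℕ → Set (Site P 0)) → BDetSet P) {Z Λ : Set (Site P 0)} {k : ℕ} (hk : k ≤ P.m + P.K)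
    (hbd0 : ∀ b : PBond P 0, b.src ∉ maxDomT M₁ Z 1 → b.tgt ∉ maxDomT M₁ Z 1 → b ∈ bd k (maxDomT M₁ Z) 0)
    (hfar : ∀ b : PBond P 0, b.src ∉ maxDomT M₁ Z 1 → (⟨blockIter k b.src, b.dir⟩ : PBond P k) ∉ bondsOf (pts k Λ))
    {W W₀ : GaugeField P k SU2} (hW : ∀ c, c ∉ bondsOf (pts k Λ) → W c = W₀ c)
    (hsol : ∃ U₀, IsMinimizerB av reg (bd k (maxDomT M₁ Z)) (avgFamily av (qsstarGIter0 k W)) U₀) :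
    fun177stdB (Node00.bgOfRecordB av reg) M₁ bd Z k W =
      wilsonLoc ((plaqsOf (maxDomT M₁ Z 1)).indicator fun _ => (1 : ℝ)) (bgKZstdB (Node00.bgOfRecordB av reg) M₁ bd Z k W) +
        wilsonLoc (fun p => 1 - (plaqsOf (maxDomT M₁ Z 1)).indicator (fun _ => (1 : ℝ)) p) (qsstarGIter0 k W₀) := by
  have hζfar : ∀ p : Plaq P 0, 1 - (plaqsOf (maxDomT M₁ Z 1)).indicator (fun _ => (1 : ℝ)) p ≠ 0 → p ∉ plaqsOf (maxDomT M₁ Z 1) := by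
    intro p hp hmem
    apply hp
    simp only [Set.indicator_of_mem hmem, sub_self]
  have hU : bgKZstdB (Node00.bgOfRecordB av reg) M₁ bd Z k W = Node00.UminOfRecordB av reg (bd k (maxDomT M₁ Z)) (avgFamily av (qsstarGIter0 k W)) := by
    rw [bgKZstdB_apply, Node00.bgOfRecordB_U]
  have hmin := Node00.isMinimizerB_UminOfRecordB av reg hsol
  have h1 : wilsonLoc (fun p => 1 - (plaqsOf (maxDomT M₁ Z 1)).indicator (fun _ => (1 : ℝ)) p)
      (Node00.UminOfRecordB av reg (bd k (maxDomT M₁ Z)) (avgFamily av (qsstarGIter0 k W))) =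
      wilsonLoc (fun p => 1 - (plaqsOf (maxDomT M₁ Z 1)).indicator (fun _ => (1 : ℝ)) p) (qsstarGIter0 k W) :=
    wilsonLoc_congr _ fun p hp => plaqHol_congr_of_not_mem_plaqsOf₂ (fun b hs ht => IsMinimizerB.pinned₂ hbd0 hmin b hs ht) (hζfar p hp)
  have h2 : wilsonLoc (fun p => 1 - (plaqsOf (maxDomT M₁ Z 1)).indicator (fun _ => (1 : ℝ)) p) (qsstarGIter0 k W) =
      wilsonLoc (fun p => 1 - (plaqsOf (maxDomT M₁ Z 1)).indicator (fun _ => (1 : ℝ)) p) (qsstarGIter0 k W₀) :=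
    wilsonLoc_congr _ fun p hp => plaqHol_congr_of_not_mem_plaqsOf (fun b hb => qsstarGIter0_congr_of_far hk hfar hW b hb) (hζfar p hp)
  rw [fun177stdB_eq, hU, eq115 ((plaqsOf (maxDomT M₁ Z 1)).indicator fun _ => (1 : ℝ)), h1, h2]

/-- ★★ **THE TRANSFER LETTER ON THE (J0′) MINIMISER-FAMILY ROAD OVER A BOND DATUM, DISCHARGED** — for `bg := Node00.bgOfRecordB av reg` over `bd` (clause `hbd0`), `k ≤ m + K`, `hfar`, a datum `W₀`
and any radius `R > 0`: IF every `exp(iB′)·W₀` with `‖B′‖ < R` has a solvable (1.74) problem on the bonds `bd k {Ω_j(Z)}`, THEN with `C := A_far(Q_k^{s*}W₀)` every `W` equal to `W₀` off the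
`Λ`-bonds and bondwise `R∕2`-close to `W₀` has `A(U_{k,Z}(W)) = A_near(U_{k,Z}(W)) + C`; twin of `transferLetter_of_minimiserFamily`.
[cite: Balaban1989LargeFieldI, (1.74) p.192, (1.77) p.194; Balaban1989LargeFieldII, (1.15) p.359; Balaban1985Variational, (5) p.278, Prop. 9 p.309; Balaban1988Convergent, (2.12) p.256; Balaban1984PropagatorsII, (2.3) p.224] -/
theorem transferLetterB_of_minimiserFamily (av : ∀ j, Averaging P j SU2) (reg : Set (GaugeField P 0 SU2)) (M₁ : ℕ)
    (bd : ℕ → (ℕ → Set (Site P 0)) → BDetSet P) {Z Λ : Set (Site P 0)} {k : ℕ} (hk : k ≤ P.m + P.K)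
    (hbd0 : ∀ b : PBond P 0, b.src ∉ maxDomT M₁ Z 1 → b.tgt ∉ maxDomT M₁ Z 1 → b ∈ bd k (maxDomT M₁ Z) 0)
    (hfar : ∀ b : PBond P 0, b.src ∉ maxDomT M₁ Z 1 → (⟨blockIter k b.src, b.dir⟩ : PBond P k) ∉ bondsOf (pts k Λ))
    (W₀ : GaugeField P k SU2) {R : ℝ} (hR : 0 < R)
    (hreal : ∀ B' : VecField P k E3, ‖B'‖ < R → ∃ U₀, IsMinimizerB av reg (bd k (maxDomT M₁ Z)) (avgFamily av (qsstarGIter0 k (expMul su2Chart B' W₀))) U₀) :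
    ∃ C : ℝ, ∀ W : GaugeField P k SU2, (∀ c, c ∉ bondsOf (pts k Λ) → W c = W₀ c) → (∀ b, dist1 (W b * (W₀ b)⁻¹) < R / 2) →
      fun177stdB (Node00.bgOfRecordB av reg) M₁ bd Z k W =
        wilsonLoc ((plaqsOf (maxDomT M₁ Z 1)).indicator fun _ => (1 : ℝ)) (bgKZstdB (Node00.bgOfRecordB av reg) M₁ bd Z k W) + C := by
  refine ⟨wilsonLoc (fun p => 1 - (plaqsOf (maxDomT M₁ Z 1)).indicator (fun _ => (1 : ℝ)) p) (qsstarGIter0 k W₀), fun W hW hclose => ?_⟩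
  -- the datum of `W` is solvable: `W = exp(iB′)·W₀` with `‖B′‖ ≤ (π/2)(R/2) < R`
  obtain ⟨B', hWB, hB'⟩ := exists_expMul_eq_of_dist1 W W₀
  have hB'R : ‖B'‖ < R := by
    rw [pi_norm_lt_iff hR]
    intro b
    calc ‖B' b‖ ≤ Real.pi / 2 * dist1 (W b * (W₀ b)⁻¹) := hB' b
      _ ≤ Real.pi / 2 * (R / 2) := mul_le_mul_of_nonneg_left (hclose b).le (by positivity)
      _ < 2 * (R / 2) := mul_lt_mul_of_pos_right (by linarith [Real.pi_lt_four]) (by linarith)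
      _ = R := by ring
  have hsol : ∃ U₀, IsMinimizerB av reg (bd k (maxDomT M₁ Z)) (avgFamily av (qsstarGIter0 k W)) U₀ := by
    rw [hWB]; exact hreal B' hB'R
  exact fun177stdB_eq_nearValue_add_far_of_isMinimizerB av reg M₁ bd hk hbd0 hfar hW hsol

/-- The transfer letter at PRINT'S [II] (2.3) FAMILY `lamDatumP` (`1 ≤ M₁`, `0 < k ≤ m + K`, `side L M₁ k ∣ sitesPerDir 0`: the level-`0` clause discharged).
[cite: Balaban1989LargeFieldI, (1.74) p.192, (1.77) p.194; Balaban1984PropagatorsII, (2.3) p.224; Balaban1988Convergent, (2.13) pp.256–257] -/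
theorem transferLetterB_of_minimiserFamily_lamDatumP (av : ∀ j, Averaging P j SU2) (reg : Set (GaugeField P 0 SU2)) {M₁ : ℕ} (hM : 1 ≤ M₁)
    {Z Λ : Set (Site P 0)} {k : ℕ} (hk0 : 0 < k) (hk : k ≤ P.m + P.K) (hdiv : side P.L M₁ k ∣ P.sitesPerDir 0)
    (hfar : ∀ b : PBond P 0, b.src ∉ maxDomT M₁ Z 1 → (⟨blockIter k b.src, b.dir⟩ : PBond P k) ∉ bondsOf (pts k Λ))
    (W₀ : GaugeField P k SU2) {R : ℝ} (hR : 0 < R)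
    (hreal : ∀ B' : VecField P k E3, ‖B'‖ < R → ∃ U₀, IsMinimizerB av reg (lamDatumP k (maxDomT M₁ Z)) (avgFamily av (qsstarGIter0 k (expMul su2Chart B' W₀))) U₀) :
    ∃ C : ℝ, ∀ W : GaugeField P k SU2, (∀ c, c ∉ bondsOf (pts k Λ) → W c = W₀ c) → (∀ b, dist1 (W b * (W₀ b)⁻¹) < R / 2) →
      fun177stdB (Node00.bgOfRecordB av reg) M₁ lamDatumP Z k W =
        wilsonLoc ((plaqsOf (maxDomT M₁ Z 1)).indicator fun _ => (1 : ℝ)) (bgKZstdB (Node00.bgOfRecordB av reg) M₁ lamDatumP Z k W) + C :=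
  transferLetterB_of_minimiserFamily av reg M₁ lamDatumP hk (fun b hs ht => mem_lamDatumP_maxDomT_zero_of_not_mem₂ hM hk0 hk hdiv b hs ht) hfar W₀ hR hreal

end TransferB

end Literature.MathematicalPhysics.QuantumFieldTheory.Balaban1983to89.B15Prop1CoerciveEditionNearRadius

end
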